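import Literature.NumberTheory.Transcendental.BetaSymbolGroup

/-!
# `GammaHodgeSector`, line `koblitz-ogus-halving`: the span lift (`stub_spanLift`)

Stub `stub_spanLift` of the crux `GammaHodgeSector` (stmt-KontsevichZagierPeriods-3742, route
TerasomaMultiplication): at an even level `D`, every element of the Koblitz–Ogus span `koSpan D`
(reflection vectors `e_a + e_{-a}`, distribution vectors `Σ_{x ≡ y (M)} e_x − e_{(D/M) y}`,
`M ∣ D`) which is the class vector of a level-`D` element of the Beta symbol group is the class
vector of a level-`D` symbol congruent to a multiple of `[½,½]` modulo the standard relators.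
Pure algebra on `ℤ/D` and `ℤ[ℚ × ℚ]`: reflection vectors are the classes of the reflection
symbols `[i/D, 1 − i/D]` plus the unit `[1,1]` (`reflVec_mem_of`); a distribution vector is
`Σ_{k=1}^{n−1} e_{kM}` — reflection vectors and, for `n` even, one `e_{D/2}` (`sum_single_mem`,
pairing `k ↔ n − k`) — minus the class of the Gauss multiplication relator
`msym (multL n s) − msym (multR n s)`, `s = (r + D)/D`, `r = y mod M` (`distVec_eq`: the fibre
`{r + jM}` of `KoblitzOgus.sum_fiber_eq_sum_range` and a telescoping sum); the coefficient of
`e_{D/2}` is even because the mass functional `g ↦ Σ_x g(x)·x ∈ ℤ/D` kills the class vectors of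
level-`D` symbols (`mass_clD_eq_zero`), and `2 e_{D/2} = e_{D/2} + e_{−D/2}` is a reflection vector.

Reference: P. Deligne, *Hodge cycles on abelian varieties*, LNM 900 (1982), §7, Rem. 7.16 (a)
(appendix by Koblitz–Ogus).
-/

noncomputable section

open scoped BigOperators

namespace Summit.KontsevichZagierPeriods.GammaHodgeSectorKO

open Literature.NumberTheory.Transcendental Literature.NumberTheory.Transcendental.BetaSymbol

variable {D : ℕ}

/-- `toZMod` from a witness `a · D = z ∈ ℤ`. [folklore] -/
private theorem toZMod_eq_of_mul_eq {a : ℚ} {z : ℤ} (c : ZMod D) (h : a * D = z)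
    (hc : (z : ZMod D) = c) : toZMod D a = c := by
  rw [toZMod, h, Rat.num_intCast, hc]

/-- A positive rational `a` with `a · D ∈ ℤ` is of level `D`. [folklore] -/
private theorem isLevel_of_mul_eq {a : ℚ} {z : ℤ} (ha : 0 < a) (h : a * D = z) : IsLevel D a :=
  ⟨ha, by rw [h, Rat.den_intCast]⟩

/-- For `a` of level `D`, `a · D` is its own numerator. [folklore] -/
private theorem mul_eq_num_of_isLevel {a : ℚ} (ha : IsLevel D a) : a * D = ((a * D).num : ℚ) :=
  ((Rat.den_eq_one_iff _).mp ha.2).symm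

/-- `toZMod D` is additive on rationals of level `D`. [folklore] -/
private theorem toZMod_add {a b : ℚ} (ha : IsLevel D a) (hb : IsLevel D b) :
    toZMod D (a + b) = toZMod D a + toZMod D b := by
  refine toZMod_eq_of_mul_eq _ (z := (a * D).num + (b * D).num) ?_ (by rw [Int.cast_add]; rfl)
  rw [add_mul, Int.cast_add, ← mul_eq_num_of_isLevel ha, ← mul_eq_num_of_isLevel hb]

/-- The basis vector `e_{[a]}` as a `Pi.single`. [folklore] -/
private theorem eZ_eq_single (a : ℚ) : eZ D a = Pi.single (toZMod D a) (1 : ℤ) := by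
  funext x; simp [eZ, Pi.single_apply]

/-- The reflection vector is `e_a + e_{-a}`. [folklore] -/
private theorem reflVec_eq (a : ZMod D) :
    reflVec D a = Pi.single a (1 : ℤ) + Pi.single (-a) (1 : ℤ) := by
  funext x
  simp only [reflVec, Pi.add_apply, Pi.single_apply, eq_comm (a := a) (b := x),
    eq_comm (a := -a) (b := x)]

/-- `msym` of the Gauss word `multL`. [folklore] -/
private theorem msym_multL (n : ℕ) (s : ℚ) :
    msym (multL n s) = ∑ k ∈ Finset.range (n - 1), bsym (((k + 1 : ℕ) : ℚ) / n) s := by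
  rw [msym, multL, Multiset.map_map, Finset.sum_eq_multiset_sum]; rfl

/-- `msym` of the Gauss word `multR`. [folklore] -/
private theorem msym_multR (n : ℕ) (s : ℚ) :
    msym (multR n s) = ∑ j ∈ Finset.range (n - 1), bsym s (((j + 1 : ℕ) : ℚ) * s) := by
  rw [msym, multR, Multiset.map_map, Finset.sum_eq_multiset_sum]; rfl

/-- **Pairing.** `Σ_{k=1}^{n-1} e_{kM}` (`D = nM`) lies in every subgroup containing the reflection
vectors and `e_{D/2}`: pair `k` with `n - k`; a fixed point `k = n/2` contributes `e_{D/2}`.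
[folklore] -/
private theorem sum_single_mem {H : AddSubgroup (ZMod D → ℤ)} (hr : ∀ a, reflVec D a ∈ H)
    (he : Pi.single (((D / 2 : ℕ)) : ZMod D) (1 : ℤ) ∈ H) {M m : ℕ}
    (hDM : D = M * (m + 1)) :
    ∑ k ∈ Finset.range m, Pi.single ((((k + 1) * M : ℕ)) : ZMod D) (1 : ℤ) ∈ H := by
  rw [← QuotientAddGroup.eq_zero_iff, ← QuotientAddGroup.mk'_apply, map_sum]
  refine Finset.sum_involution (fun k _ => m - 1 - k) ?_ ?_ ?_ ?_
  · intro k hk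
    rw [Finset.mem_range] at hk
    rw [← map_add, QuotientAddGroup.mk'_apply, QuotientAddGroup.eq_zero_iff]
    have hsum : (k + 1) * M + (m - 1 - k + 1) * M = D := by
      rw [← add_mul, show k + 1 + (m - 1 - k + 1) = m + 1 by omega, hDM, mul_comm]
    have hneg : -((((k + 1) * M : ℕ)) : ZMod D) = (((m - 1 - k + 1) * M : ℕ) : ZMod D) := by
      refine neg_eq_of_add_eq_zero_right ?_
      rw [← Nat.cast_add, hsum, ZMod.natCast_self]
    have h := hr ((((k + 1) * M : ℕ)) : ZMod D)
    rwa [reflVec_eq, hneg] at h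
  · intro k hk hne heq
    rw [Finset.mem_range] at hk
    apply hne
    rw [QuotientAddGroup.mk'_apply, QuotientAddGroup.eq_zero_iff]
    have heq' : m - 1 - k = k := heq
    have hm : m + 1 = (k + 1) * 2 := by omega
    rw [← Nat.div_eq_of_eq_mul_left two_pos (by rw [hDM, hm]; ring : D = (k + 1) * M * 2)]
    exact he
  · intro k hk; simp only [Finset.mem_range] at hk ⊢; omega
  · intro k hk; simp only [Finset.mem_range] at hk; omega

/-- Class vector of the Gauss word `multL n s` for `D = M n`, `s D ≡ r (mod D)`:
`Σ_{k=1}^{n-1} (e_{kM} + e_r - e_{r+kM})`. [folklore] -/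
private theorem clD_msym_multL {M m r : ℕ} (hDM : D = M * (m + 1)) {s : ℚ}
    (hs : s * D = ((r + D : ℕ) : ℤ)) :
    clD D (msym (multL (m + 1) s)) =
      ∑ k ∈ Finset.range m, Pi.single ((((k + 1) * M : ℕ)) : ZMod D) (1 : ℤ)
        + m • Pi.single ((r : ℕ) : ZMod D) (1 : ℤ)
        - ∑ k ∈ Finset.range m, Pi.single (((r + (k + 1) * M : ℕ)) : ZMod D) (1 : ℤ) := by
  have hDq : (D : ℚ) = (M : ℚ) * ((m + 1 : ℕ) : ℚ) := by exact_mod_cast hDM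
  have hm0 : ((m + 1 : ℕ) : ℚ) ≠ 0 := by positivity
  have hsr : toZMod D s = ((r : ℕ) : ZMod D) := toZMod_eq_of_mul_eq _ hs (by simp)
  have hterm : ∀ k ∈ Finset.range m,
      clD D (bsym (((k + 1 : ℕ) : ℚ) / ((m + 1 : ℕ) : ℚ)) s) =
        Pi.single ((((k + 1) * M : ℕ)) : ZMod D) (1 : ℤ) + Pi.single ((r : ℕ) : ZMod D) 1
          - Pi.single (((r + (k + 1) * M : ℕ)) : ZMod D) 1 := by
    intro k _
    have hk : (((k + 1 : ℕ) : ℚ) / ((m + 1 : ℕ) : ℚ)) * D = ((((k + 1) * M : ℕ)) : ℤ) := by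
      rw [hDq, mul_comm (M : ℚ), ← mul_assoc, div_mul_cancel₀ _ hm0]; push_cast; ring
    rw [clD_bsym, eZ_eq_single, eZ_eq_single, eZ_eq_single,
      toZMod_eq_of_mul_eq ((((k + 1) * M : ℕ)) : ZMod D) hk (by simp), hsr,
      toZMod_eq_of_mul_eq (((r + (k + 1) * M : ℕ)) : ZMod D)
        (z := ((((k + 1) * M : ℕ)) : ℤ) + ((r + D : ℕ) : ℤ))
        (by rw [add_mul, hk, hs, Int.cast_add]) (by push_cast; rw [ZMod.natCast_self]; ring)]
  rw [msym_multL, map_sum, Nat.add_sub_cancel, Finset.sum_congr rfl hterm, Finset.sum_sub_distrib,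
    Finset.sum_add_distrib, Finset.sum_const, Finset.card_range]

/-- Class vector of the Gauss word `multR n s`, `s D ≡ r (mod D)`: `(n-1) e_r + e_r - e_{n r}`
(telescoping). [folklore] -/
private theorem clD_msym_multR {m r : ℕ} {s : ℚ} (hs : s * D = ((r + D : ℕ) : ℤ)) :
    clD D (msym (multR (m + 1) s)) =
      m • Pi.single ((r : ℕ) : ZMod D) (1 : ℤ) +
        (Pi.single ((((0 + 1) * r : ℕ)) : ZMod D) (1 : ℤ)
          - Pi.single ((((m + 1) * r : ℕ)) : ZMod D) 1) := by
  have hsr : toZMod D s = ((r : ℕ) : ZMod D) := toZMod_eq_of_mul_eq _ hs (by simp)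
  have hterm : ∀ j ∈ Finset.range m, clD D (bsym s (((j + 1 : ℕ) : ℚ) * s)) =
      Pi.single ((r : ℕ) : ZMod D) (1 : ℤ) +
        (Pi.single ((((j + 1) * r : ℕ)) : ZMod D) (1 : ℤ)
          - Pi.single ((((j + 1 + 1) * r : ℕ)) : ZMod D) 1) := by
    intro j _
    have hj : (((j + 1 : ℕ) : ℚ) * s) * D = ((((j + 1) * (r + D) : ℕ)) : ℤ) := by
      rw [mul_assoc, hs]; push_cast; ring
    have hj' : (s + ((j + 1 : ℕ) : ℚ) * s) * D = ((((j + 1 + 1) * (r + D) : ℕ)) : ℤ) := by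
      rw [add_mul, mul_assoc, hs]; push_cast; ring
    rw [clD_bsym, eZ_eq_single, eZ_eq_single, eZ_eq_single, hsr,
      toZMod_eq_of_mul_eq ((((j + 1) * r : ℕ)) : ZMod D) hj
        (by push_cast; rw [ZMod.natCast_self]; ring),
      toZMod_eq_of_mul_eq ((((j + 1 + 1) * r : ℕ)) : ZMod D) hj'
        (by push_cast; rw [ZMod.natCast_self]; ring), add_sub_assoc]
  rw [msym_multR, map_sum, Nat.add_sub_cancel, Finset.sum_congr rfl hterm, Finset.sum_add_distrib,
    Finset.sum_const, Finset.card_range, Finset.sum_range_sub']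

variable [NeZero D]


/-- The mass `Σ_x e_c(x) · x = c`. [folklore] -/
private theorem mass_single (c : ZMod D) :
    ∑ x : ZMod D, (((Pi.single c (1 : ℤ) : ZMod D → ℤ) x : ℤ) : ZMod D) * x = c := by
  simp [Pi.single_apply]

/-- **Mass.** The functional `g ↦ Σ_x g(x) · x ∈ ℤ/D` kills the class vectors of level-`D`
symbols (`[a] + [b] - [a + b] = 0` for `a, b` of level `D`). [folklore] -/
private theorem mass_clD_eq_zero {v : BSym} (hv : v ∈ levelSym D) :
    ∑ x : ZMod D, ((clD D v x : ℤ) : ZMod D) * x = 0 := by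
  induction hv using AddSubgroup.closure_induction with
  | mem w hw =>
    obtain ⟨a, b, ha, hb, rfl⟩ := hw
    simp only [clD_bsym, eZ_eq_single, Pi.add_apply, Pi.sub_apply, Int.cast_add, Int.cast_sub,
      add_mul, sub_mul, Finset.sum_add_distrib, Finset.sum_sub_distrib, mass_single,
      toZMod_add ha hb, sub_self]
  | zero => simp
  | add u w _ _ hu hw =>
    simp only [map_add, Pi.add_apply, Int.cast_add, add_mul, Finset.sum_add_distrib, hu, hw,
      add_zero]
  | neg u _ hu =>
    simp only [map_neg, Pi.neg_apply, Int.cast_neg, neg_mul, Finset.sum_neg_distrib, hu, neg_zero]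

/-- **Reflections.** Every reflection vector is the class vector of a reflection symbol plus the
unit symbol (`e_a + e_{-a} = cl [i/D, 1 - i/D] + cl [1,1]`, `e_0 + e_0 = 2 cl [1,1]`), hence lies in
every subgroup containing the classes of the level-`D` symbols congruent to a multiple of `[½,½]`
modulo the relators. [folklore] -/
private theorem reflVec_mem_of {H : AddSubgroup (ZMod D → ℤ)}
    (hH : ∀ s ∈ levelSym D, ∀ e : ℤ, s - e • bsym (1 / 2) (1 / 2) ∈ RelSpan →
      clD D s ∈ H)
    (a : ZMod D) : reflVec D a ∈ H := by
  have hD0 : (D : ℚ) ≠ 0 := by exact_mod_cast NeZero.ne D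
  have hDpos : (0 : ℚ) < D := by exact_mod_cast Nat.pos_of_ne_zero (NeZero.ne D)
  -- the unit symbol `[1, 1]`, of class `e_0`
  have h1 : (1 : ℚ) * D = ((D : ℕ) : ℤ) := by push_cast; ring
  have h11 : ((1 : ℚ) + 1) * D = ((2 * D : ℕ) : ℤ) := by push_cast; ring
  have hυ : clD D (bsym 1 1) = Pi.single (0 : ZMod D) (1 : ℤ) := by
    rw [clD_bsym, eZ_eq_single, eZ_eq_single, toZMod_eq_of_mul_eq 0 h1 (by simp),
      toZMod_eq_of_mul_eq 0 h11 (by simp), add_sub_cancel_right]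
  have hυH : clD D (bsym 1 1) ∈ H := by
    refine hH _ (bsym_mem_levelSym (isLevel_of_mul_eq one_pos h1) (isLevel_of_mul_eq one_pos h1))
      0 ?_
    have h := sub_mem_relSpan (L := {((1 : ℚ), (1 : ℚ))}) (R := 0) (Or.inr rfl)
    simpa using h
  by_cases ha : a = 0
  · subst ha
    rw [reflVec_eq, neg_zero, ← hυ]
    exact add_mem hυH hυH
  · have hi0 : 0 < a.val := ZMod.val_pos.mpr ha
    have hiD : a.val < D := ZMod.val_lt a
    have hia : ((a.val : ℕ) : ZMod D) = a := ZMod.natCast_zmod_val a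
    have hq1 : ((a.val : ℚ) / D) * D = ((a.val : ℕ) : ℤ) := by
      rw [div_mul_cancel₀ _ hD0, Int.cast_natCast]
    have hq2 : (1 - (a.val : ℚ) / D) * D = ((D - a.val : ℕ) : ℤ) := by
      rw [sub_mul, one_mul, div_mul_cancel₀ _ hD0, Nat.cast_sub hiD.le]; push_cast; ring
    have hq12 : ((a.val : ℚ) / D + (1 - (a.val : ℚ) / D)) * D = ((D : ℕ) : ℤ) := by
      rw [add_sub_cancel, one_mul]; simp
    have hpos1 : (0 : ℚ) < a.val / D := div_pos (by exact_mod_cast hi0) hDpos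
    have hlt1 : (a.val : ℚ) / D < 1 := (div_lt_one hDpos).2 (by exact_mod_cast hiD)
    have hpos2 : (0 : ℚ) < 1 - a.val / D := sub_pos.2 hlt1
    have hρ : clD D (bsym ((a.val : ℚ) / D) (1 - (a.val : ℚ) / D)) =
        Pi.single a (1 : ℤ) + Pi.single (-a) 1 - Pi.single (0 : ZMod D) 1 := by
      rw [clD_bsym, eZ_eq_single, eZ_eq_single, eZ_eq_single,
        toZMod_eq_of_mul_eq a hq1 (by rw [Int.cast_natCast, hia]),
        toZMod_eq_of_mul_eq (-a) hq2
          (by rw [Int.cast_natCast, Nat.cast_sub hiD.le, ZMod.natCast_self, zero_sub, hia]),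
        toZMod_eq_of_mul_eq 0 hq12 (by simp)]
    have hρH : clD D (bsym ((a.val : ℚ) / D) (1 - (a.val : ℚ) / D)) ∈ H := by
      refine hH _ (bsym_mem_levelSym (isLevel_of_mul_eq hpos1 hq1) (isLevel_of_mul_eq hpos2 hq2))
        1 ?_
      have h := sub_mem_relSpan (Or.inl (Or.inr ⟨(a.val : ℚ) / D, hpos1, hlt1, rfl⟩))
      simpa using h
    have hsum : reflVec D a =
        clD D (bsym ((a.val : ℚ) / D) (1 - (a.val : ℚ) / D)) + clD D (bsym 1 1) := by
      rw [hρ, hυ, reflVec_eq]; abel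
    rw [hsum]
    exact add_mem hρH hυH

/-- **Distributions, as classes.** For `D = M n`, `r = y mod M` and `s D = r + D`:
`distVec D M y = Σ_{k=1}^{n-1} e_{kM} - cl (msym (multL n s) - msym (multR n s))` (the fibre of
`y` is `{r + jM}`, `(D/M)·y = n r`, and the two Gauss words telescope). [folklore] -/
private theorem distVec_eq {M m : ℕ} (hDM : D = M * (m + 1)) (y : ZMod D) {s : ℚ}
    (hs : s * D = ((y.val % M + D : ℕ) : ℤ)) :
    distVec D M y = ∑ k ∈ Finset.range m, Pi.single ((((k + 1) * M : ℕ)) : ZMod D) (1 : ℤ) -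
      clD D (msym (multL (m + 1) s) - msym (multR (m + 1) s)) := by
  have hM0 : M ≠ 0 := by rintro rfl; exact NeZero.ne D (by rw [hDM, zero_mul])
  have hMd : M ∣ D := ⟨m + 1, hDM⟩
  have hn : D / M = m + 1 := by rw [hDM, Nat.mul_div_cancel_left _ (Nat.pos_of_ne_zero hM0)]
  have hny : ((D / M : ℕ) : ZMod D) * y = ((((m + 1) * (y.val % M) : ℕ)) : ZMod D) := by
    rw [← ZMod.natCast_zmod_val (((D / M : ℕ) : ZMod D) * y), KoblitzOgus.val_div_mul hMd, hn]
  have hfib : ∀ x : ZMod D, (if x.val % M = y.val % M then (1 : ℤ) else 0) =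
      ∑ j ∈ Finset.range (m + 1),
        if x = ((y.val % M + j * M : ℕ) : ZMod D) then (1 : ℤ) else 0 := by
    intro x
    have h := KoblitzOgus.sum_fiber_eq_sum_range hMd y (fun z => if x = z then (1 : ℤ) else 0)
    simp only [Finset.sum_ite_eq, Finset.mem_filter, Finset.mem_univ, true_and, hn] at h
    exact h
  have hdist : distVec D M y =
      ∑ j ∈ Finset.range (m + 1), Pi.single ((y.val % M + j * M : ℕ) : ZMod D) (1 : ℤ)
        - Pi.single ((((m + 1) * (y.val % M) : ℕ)) : ZMod D) (1 : ℤ) := by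
    funext x
    simp only [distVec, Pi.sub_apply, Finset.sum_apply, Pi.single_apply, hny, hfib x,
      eq_comm (a := ((((m + 1) * (y.val % M) : ℕ)) : ZMod D)) (b := x)]
  rw [hdist, map_sub, clD_msym_multL hDM hs, clD_msym_multR hs, Finset.sum_range_succ']
  simp only [zero_mul, add_zero, zero_add, one_mul]
  abel

/-- The Gauss relator symbol at level `D`: for `D = M n` and `s = (r + D)/D`,
`msym (multL n s) - msym (multR n s)` is a level-`D` element of `RelSpan`. [folklore] -/
private theorem multRel_mem {M m : ℕ} (r : ℕ) (hDM : D = M * (m + 1)) :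
    msym (multL (m + 1) (((r + D : ℕ) : ℚ) / D)) -
        msym (multR (m + 1) (((r + D : ℕ) : ℚ) / D)) ∈ levelSym D ∧
      msym (multL (m + 1) (((r + D : ℕ) : ℚ) / D)) -
        msym (multR (m + 1) (((r + D : ℕ) : ℚ) / D)) ∈ RelSpan := by
  have hD0 : (D : ℚ) ≠ 0 := by exact_mod_cast NeZero.ne D
  have hDpos : (0 : ℚ) < D := by exact_mod_cast Nat.pos_of_ne_zero (NeZero.ne D)
  have hDq : (D : ℚ) = (M : ℚ) * ((m + 1 : ℕ) : ℚ) := by exact_mod_cast hDM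
  have hm0 : ((m + 1 : ℕ) : ℚ) ≠ 0 := by positivity
  have hs : (((r + D : ℕ) : ℚ) / D) * D = ((r + D : ℕ) : ℤ) := by
    rw [div_mul_cancel₀ _ hD0, Int.cast_natCast]
  have hrD : 0 < r + D := by have := Nat.pos_of_ne_zero (NeZero.ne D); omega
  have hspos : (0 : ℚ) < ((r + D : ℕ) : ℚ) / D := div_pos (by exact_mod_cast hrD) hDpos
  have hslev : IsLevel D (((r + D : ℕ) : ℚ) / D) := isLevel_of_mul_eq hspos hs
  constructor
  · rw [msym_multL, msym_multR, Nat.add_sub_cancel]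
    refine sub_mem (sum_mem fun k _ => bsym_mem_levelSym ?_ hslev)
      (sum_mem fun j _ => bsym_mem_levelSym hslev ?_)
    · refine isLevel_of_mul_eq (by positivity) (z := ((((k + 1) * M : ℕ)) : ℤ)) ?_
      rw [hDq, mul_comm (M : ℚ), ← mul_assoc, div_mul_cancel₀ _ hm0]; push_cast; ring
    · refine isLevel_of_mul_eq (mul_pos (by positivity) hspos)
        (z := ((((j + 1) * (r + D) : ℕ)) : ℤ)) ?_
      rw [mul_assoc, hs]; push_cast; ring
  · rcases Nat.eq_zero_or_pos m with rfl | hm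
    · simp [multL, multR]
    · exact sub_mem_relSpan (Or.inl (Or.inl (Or.inr ⟨m + 1, _, by omega, hspos, rfl⟩)))

/-- **Distributions.** Every distribution vector (`M ∣ D`) lies in every subgroup containing the
class vectors of the level-`D` symbols congruent to multiples of `[½,½]` and `e_{D/2}`.
[folklore] -/
private theorem distVec_mem_of {H : AddSubgroup (ZMod D → ℤ)}
    (hH : ∀ s ∈ levelSym D, ∀ e : ℤ, s - e • bsym (1 / 2) (1 / 2) ∈ RelSpan →
      clD D s ∈ H)
    (he : Pi.single (((D / 2 : ℕ)) : ZMod D) (1 : ℤ) ∈ H) {M : ℕ} (hM : M ∣ D)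
    (y : ZMod D) : distVec D M y ∈ H := by
  obtain ⟨-, hn0, hDM⟩ := KoblitzOgus.div_ne_zero_of_dvd hM
  obtain ⟨m, hm⟩ := Nat.exists_eq_add_one_of_ne_zero hn0
  rw [hm] at hDM
  have hD0 : (D : ℚ) ≠ 0 := by exact_mod_cast NeZero.ne D
  have hs : (((y.val % M + D : ℕ) : ℚ) / D) * D = ((y.val % M + D : ℕ) : ℤ) := by
    rw [div_mul_cancel₀ _ hD0, Int.cast_natCast]
  rw [distVec_eq hDM y hs]
  obtain ⟨hlev, hrel⟩ := multRel_mem (y.val % M) hDM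
  exact sub_mem (sum_single_mem (fun a => reflVec_mem_of hH a) he hDM)
    (hH _ hlev 0 (by simpa using hrel))

/-- STUB (span lift). At an even level `D`, every element of the Koblitz–Ogus span which is the
class vector of some level-`D` symbol is the class vector of a level-`D` symbol congruent to a
multiple of `[½, ½]` modulo the standard relators.
[cite: Deligne1982HodgeCycles, Rem. 7.16 (a)] -/
theorem stub_spanLift (D : ℕ) [NeZero D] (h2 : 2 ∣ D) (t : ZMod D → ℤ) (ht : t ∈ koSpan D)
    (hrange : ∃ v ∈ levelSym D, clD D v = t) :
    ∃ s ∈ levelSym D, clD D s = t ∧ ∃ e : ℤ, s - e • bsym (1 / 2) (1 / 2) ∈ RelSpan := by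
  -- the image `K` of the good subgroup `levelSym D ⊓ (RelSpan + ℤ [½,½])`
  let K : AddSubgroup (ZMod D → ℤ) :=
    (levelSym D ⊓ (RelSpan ⊔ AddSubgroup.zmultiples (bsym (1 / 2) (1 / 2)))).map (clD D)
  have hGK : ∀ s ∈ levelSym D, ∀ e : ℤ, s - e • bsym (1 / 2) (1 / 2) ∈ RelSpan →
      clD D s ∈ K := by
    intro s hs e he
    refine AddSubgroup.mem_map_of_mem _ (AddSubgroup.mem_inf.2 ⟨hs, ?_⟩)
    have h := AddSubgroup.add_mem_sup he (AddSubgroup.zsmul_mem_zmultiples (bsym (1 / 2) (1 / 2)) e)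
    rwa [sub_add_cancel] at h
  have hGK' : ∀ s ∈ levelSym D, ∀ e : ℤ, s - e • bsym (1 / 2) (1 / 2) ∈ RelSpan →
      clD D s ∈ K ⊔ AddSubgroup.zmultiples (Pi.single (((D / 2 : ℕ)) : ZMod D) (1 : ℤ)) :=
    fun s hs e he => AddSubgroup.mem_sup_left (hGK s hs e he)
  -- Step 1: the Koblitz–Ogus span lies in `K + ℤ e_{D/2}`
  have hle :
      koSpan D ≤ K ⊔ AddSubgroup.zmultiples (Pi.single (((D / 2 : ℕ)) : ZMod D) (1 : ℤ)) := by
    rw [koSpan, AddSubgroup.closure_le]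
    rintro v (⟨a, rfl⟩ | ⟨M, hM, y, rfl⟩)
    · exact reflVec_mem_of hGK' a
    · exact distVec_mem_of hGK' (AddSubgroup.mem_sup_right (AddSubgroup.mem_zmultiples _))
        (Nat.dvd_of_mem_divisors hM) y
  obtain ⟨k, hk, z, hz, hkz⟩ := AddSubgroup.mem_sup.1 (hle ht)
  obtain ⟨s₀, hs₀, rfl⟩ := AddSubgroup.mem_map.1 hk
  obtain ⟨j, rfl⟩ := AddSubgroup.mem_zmultiples_iff.1 hz
  -- Step 2: parity of `j` via the mass functional
  obtain ⟨v, hv, hvt⟩ := hrange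
  have hmass : (j : ZMod D) * (((D / 2 : ℕ)) : ZMod D) = 0 := by
    have h1 := mass_clD_eq_zero hv
    rw [hvt, ← hkz] at h1
    simpa only [Pi.add_apply, Int.cast_add, add_mul, Finset.sum_add_distrib,
      mass_clD_eq_zero (AddSubgroup.mem_inf.1 hs₀).1, zero_add, Pi.smul_apply, smul_eq_mul,
      Int.cast_mul, mul_assoc, ← Finset.mul_sum, mass_single] using h1
  have hD : D ≠ 0 := NeZero.ne D
  have hj2 : (2 : ℤ) ∣ j := by
    obtain ⟨d, hd⟩ := h2
    have hd2 : D / 2 = d := by omega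
    have hd0 : (d : ℤ) ≠ 0 := by
      have : d ≠ 0 := by rintro rfl; omega
      exact_mod_cast this
    have hdvd : (D : ℤ) ∣ j * ((D / 2 : ℕ) : ℤ) := by
      rw [← ZMod.intCast_zmod_eq_zero_iff_dvd, Int.cast_mul, Int.cast_natCast]; exact hmass
    rw [hd2, hd] at hdvd
    push_cast at hdvd
    exact (mul_dvd_mul_iff_right hd0).1 hdvd
  obtain ⟨j', rfl⟩ := hj2
  have hc2 : -(((D / 2 : ℕ)) : ZMod D) = ((D / 2 : ℕ) : ZMod D) := by
    refine neg_eq_of_add_eq_zero_right ?_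
    obtain ⟨d, hd⟩ := h2
    rw [← Nat.cast_add, show D / 2 + D / 2 = D by omega, ZMod.natCast_self]
  have h2e : (2 * j') • Pi.single (((D / 2 : ℕ)) : ZMod D) (1 : ℤ) =
      j' • reflVec D (((D / 2 : ℕ)) : ZMod D) := by
    rw [reflVec_eq, hc2, ← two_smul ℤ, smul_smul, mul_comm]
  have hK2 : clD D s₀ + (2 * j') • Pi.single (((D / 2 : ℕ)) : ZMod D) (1 : ℤ) ∈ K := by
    rw [h2e]
    exact add_mem (AddSubgroup.mem_map_of_mem _ hs₀) (K.zsmul_mem (reflVec_mem_of hGK _) _)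
  obtain ⟨s, hs, hst⟩ := AddSubgroup.mem_map.1 hK2
  refine ⟨s, (AddSubgroup.mem_inf.1 hs).1, hst.trans hkz, ?_⟩
  obtain ⟨w, hw, z, hz, hwz⟩ := AddSubgroup.mem_sup.1 (AddSubgroup.mem_inf.1 hs).2
  obtain ⟨e, rfl⟩ := AddSubgroup.mem_zmultiples_iff.1 hz
  exact ⟨e, by rwa [← hwz, add_sub_cancel_right]⟩

end Summit.KontsevichZagierPeriods.GammaHodgeSectorKO
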